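import Summits.Schanuel.Schanuel.Theorems.ZilberEacParamConstFibre
import Summits.Schanuel.Schanuel.Theorems.ZilberEacParamSurfaceTransport
import HarnessLib

/-!
# Polynomially parametrised base curves, LXXXIII: MANTOVA–MASSER'S QUESTION ANSWERED over every
# polynomial curve with unequal degrees `≥ 2` — YES, unless the curve is a polynomial graph and the
# surface a constant-fibre cylinder over it

HONEST FRAMING.  Cell `pub-schanuel` (Zilber's Exponential-Algebraic Closedness, case ladder;
host summit Schanuel), seat 2, gen 27.  Assembly of file LXXIX (over `C = {(g₀(t), g₁(t))}`,
`2 ≤ deg g₀ < deg g₁`: non-dense ⟹ constant fibre) and file LXXXII (constant fibres are dense unless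
`g₁ = P ∘ g₀`):
* **`paramSurface₃_dense_or_comp`** — every `S(g; Q)` (`Q` irreducible with a zero in `(ℂˣ)²` over
  infinitely many `t`) is dense, or `g₁ = P ∘ g₀`;
* **`unprojectedDense_of_mmCase_of_base_eq_paramCurve_of_not_comp`** (+ mirror `_of_gt`) —
  **Mantova–Masser's question (PLMS 2024 §1 p. 5) holds for EVERY surface of their case whose base
  curve is a polynomially parametrised curve with `deg g₀ ≠ deg g₁`, `min ≥ 2`, that is not a
  polynomial graph** (`g₁ ∉ ℂ[g₀]`, resp. `g₀ ∉ ℂ[g₁]`);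
* **`mmCase_paramBase_answer`** — the complete answer for `2 ≤ deg g₀ < deg g₁`: a non-dense `W`
  of the case over `C` forces BOTH `g₁ = P ∘ g₀` (the curve is the graph `x₁ = P(x₀)`,
  `deg P = deg g₁ / deg g₀ ≥ 2`) AND `W = C × {Q(y₀) = 0} × ℂ` (a constant fibre) — and such
  cylinders can indeed fail (`{x₁ = x₀²/(2πi), y₀ = 1}`, seat 1 gen 9);
* examples: every `W` of the case over `(t², t⁴ + t)` (`(x₁ - x₀²)² = x₀`) and over
  `(t², i t⁴ + t)` (formerly residual: `2 ∣ 4`, vanishing phase, no gap) is dense;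
* **`unprojectedDense_of_mmCase_of_base_eq_paramCurve_of_ratRatio_of_not_comp`** — equal degrees
  with RATIONAL leading ratio `p lc₀ + q lc₁ = 0`: if the reduced pair `(G, H) = (p g₀ + q g₁,
  u g₁ - v g₀)` (`p u + q v = 1`) has `deg G ≥ 2` and `H ∉ ℂ[G]`, every `W` over the curve is dense
  (gen 21's Bezout transport).
What stays OPEN: equal degrees with real leading ratio beyond gen 20's curvature condition (the
straight real line `x₁ = √2 x₀` included); general algebraic base curves; Fib(3,2); EC(3,2); NOT
Schanuel's conjecture (neither used nor implied); EAC ⇏ SC.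
-/

noncomputable section

open Filter Topology Set Complex MvPolynomial
open Literature.NumberTheory.Transcendental Literature.ModelTheory.Zilber
open Literature.ModelTheory.ExponentialFields

set_option linter.dupNamespace false

namespace Summit.Schanuel.Schanuel.Theorems

section Main

variable (g₀ g₁ : Polynomial ℂ) {Q : MvPolynomial (Fin 3) ℂ}

/-! ## Part A. The answer over polynomial curves with unequal degrees -/

/-- **Over a polynomial curve with `2 ≤ deg g₀ < deg g₁`: every `S(g; Q)` (`Q` irreducible with a
zero in `(ℂˣ)²` over infinitely many `t`) is dense, or the curve is a polynomial graph `g₁ = P ∘ g₀`.**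
[cite: MantovaMasser2023, §1 Further remarks, p. 5 (the question, open in general)] (new) -/
theorem paramSurface₃_dense_or_comp (hd : 2 ≤ g₀.natDegree) (hlt : g₀.natDegree < g₁.natDegree)
    (hirr : Irreducible Q)
    (hfib : Set.Infinite {t : ℂ | ∃ c : Fin 2 → ℂ, c 0 ≠ 0 ∧ c 1 ≠ 0 ∧
      MvPolynomial.eval ![t, c 0, c 1] Q = 0}) :
    UnprojectedDense {w : Fin 2 ⊕ Fin 2 → ℂ | ∃ t : ℂ, w (Sum.inl 0) = g₀.eval t ∧
      w (Sum.inl 1) = g₁.eval t ∧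
      MvPolynomial.eval (Fin.cases t (fun i => w (Sum.inr i)) : Fin 3 → ℂ) Q = 0} ∨
    ∃ P : Polynomial ℂ, g₁ = P.comp g₀ := by
  by_cases hnot : UnprojectedDense {w : Fin 2 ⊕ Fin 2 → ℂ | ∃ t : ℂ, w (Sum.inl 0) = g₀.eval t ∧
      w (Sum.inl 1) = g₁.eval t ∧
      MvPolynomial.eval (Fin.cases t (fun i => w (Sum.inr i)) : Fin 3 → ℂ) Q = 0}
  · exact Or.inl hnot
  · exact unprojectedDense_constFibre_or_comp g₀ g₁ (by omega) hirr
      (paramSurface₃_support_of_not_dense g₀ g₁ hd hlt hirr hfib hnot) hfib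

/-- **MANTOVA–MASSER'S QUESTION ANSWERED YES over every polynomial curve with
`2 ≤ deg g₀ < deg g₁` that is not a polynomial graph `x₁ = P(x₀)`.**  Every `W ⊆ ℂ² × ℂ²` of their
case (dim-π-S-1-free) whose base curve is `{(g₀(t), g₁(t))}` with `g₁ ∉ ℂ[g₀]` has Zariski-dense
exponential points: `I(W ∩ Γ_exp) = I(W)`.
[cite: MantovaMasser2023, §1 Further remarks, p. 5 (the question, open in general)] (new) -/
theorem unprojectedDense_of_mmCase_of_base_eq_paramCurve_of_not_comp (hd : 2 ≤ g₀.natDegree)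
    (hlt : g₀.natDegree < g₁.natDegree) (hng : ∀ P : Polynomial ℂ, g₁ ≠ P.comp g₀)
    {W : Set (Fin 2 ⊕ Fin 2 → ℂ)} (hmm : MMCaseDimPiOneFree W)
    (hbase : zeroLocus ℂ (vanishingIdeal ℂ (projAdd '' (W ∩ torusLocus ℂ 2))) =
      {x : Fin 2 → ℂ | ∃ t : ℂ, x 0 = g₀.eval t ∧ x 1 = g₁.eval t}) :
    UnprojectedDense W := by
  obtain ⟨Q, hQ, hfib, rfl⟩ := exists_eq_paramSurface₃_of_mmCase g₀ g₁ (by omega) hmm hbase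
  rcases paramSurface₃_dense_or_comp g₀ g₁ hd hlt hQ hfib with h | ⟨P, hP⟩
  · exact h
  · exact absurd hP (hng P)

/-- **Mirror (`2 ≤ deg g₁ < deg g₀`, `g₀ ∉ ℂ[g₁]`).**
[cite: MantovaMasser2023, §1 Further remarks, p. 5 (the question, open in general)] (new) -/
theorem unprojectedDense_of_mmCase_of_base_eq_paramCurve_of_not_comp_of_gt (hd : 2 ≤ g₁.natDegree)
    (hlt : g₁.natDegree < g₀.natDegree) (hng : ∀ P : Polynomial ℂ, g₀ ≠ P.comp g₁)
    {W : Set (Fin 2 ⊕ Fin 2 → ℂ)} (hmm : MMCaseDimPiOneFree W)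
    (hbase : zeroLocus ℂ (vanishingIdeal ℂ (projAdd '' (W ∩ torusLocus ℂ 2))) =
      {x : Fin 2 → ℂ | ∃ t : ℂ, x 0 = g₀.eval t ∧ x 1 = g₁.eval t}) :
    UnprojectedDense W := by
  obtain ⟨Q, hQ, hfib, rfl⟩ := exists_eq_paramSurface₃_of_mmCase g₀ g₁ (by omega) hmm hbase
  rw [paramSurface₃_eq_indexSwapped, unprojectedDense_indexSwapped_iff]
  rcases paramSurface₃_dense_or_comp g₁ g₀ hd hlt (irreducible_rename_swap12 hQ)
    (torusFibres_rename_swap12 hfib) with h | ⟨P, hP⟩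
  · exact h
  · exact absurd hP (hng P)

/-- **THE COMPLETE ANSWER over a polynomial curve with `2 ≤ deg g₀ < deg g₁`.**  A surface `W`
of Mantova–Masser's case over `{(g₀(t), g₁(t))}` WITHOUT Zariski-dense exponential points forces:
the curve is a polynomial graph (`g₁ = P ∘ g₀`) AND `W = S(g; Q)` with `Q ∈ ℂ[y₀]` (a constant-fibre
cylinder over that graph). [cite: MantovaMasser2023, §1 Further remarks, p. 5 (the question, open
in general)] (new) -/
theorem mmCase_paramBase_answer (hd : 2 ≤ g₀.natDegree) (hlt : g₀.natDegree < g₁.natDegree)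
    {W : Set (Fin 2 ⊕ Fin 2 → ℂ)} (hmm : MMCaseDimPiOneFree W)
    (hbase : zeroLocus ℂ (vanishingIdeal ℂ (projAdd '' (W ∩ torusLocus ℂ 2))) =
      {x : Fin 2 → ℂ | ∃ t : ℂ, x 0 = g₀.eval t ∧ x 1 = g₁.eval t})
    (hnot : ¬ UnprojectedDense W) :
    (∃ P : Polynomial ℂ, g₁ = P.comp g₀) ∧
      ∃ Q : MvPolynomial (Fin 3) ℂ, Irreducible Q ∧
        W = {w : Fin 2 ⊕ Fin 2 → ℂ | ∃ t : ℂ, w (Sum.inl 0) = g₀.eval t ∧ w (Sum.inl 1) = g₁.eval t ∧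
          MvPolynomial.eval (Fin.cases t (fun i => w (Sum.inr i)) : Fin 3 → ℂ) Q = 0} ∧
        ∀ m ∈ Q.support, m 0 = 0 ∧ m 2 = 0 := by
  refine ⟨?_, mmCase_paramBase_complete g₀ g₁ hd hlt hmm hbase hnot⟩
  by_contra hng
  push Not at hng
  exact hnot (unprojectedDense_of_mmCase_of_base_eq_paramCurve_of_not_comp g₀ g₁ hd hlt hng hmm hbase)

end Main

/-! ## Part B. Examples: every surface of the case over `(t², t⁴ + t)` and over `(t², i t⁴ + t)` -/

section Example

/-- `t⁴ + t` is not a polynomial in `t²` (compare the values at `t = ±1`). -/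
theorem X_pow_four_add_X_ne_comp_X_sq (P : Polynomial ℂ) :
    (Polynomial.X ^ 4 + Polynomial.X : Polynomial ℂ) ≠ P.comp (Polynomial.X ^ 2) := by
  intro h
  have h1 := congrArg (Polynomial.eval (1 : ℂ)) h
  have h2 := congrArg (Polynomial.eval (-1 : ℂ)) h
  simp only [Polynomial.eval_add, Polynomial.eval_pow, Polynomial.eval_X, Polynomial.eval_comp] at h1 h2
  norm_num at h1 h2
  rw [← h1] at h2
  norm_num at h2

/-- **Mantova–Masser's question over the curve `(t², t⁴ + t)` — i.e. `(x₁ - x₀²)² = x₀` — holds for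
EVERY surface of their case**: `MMCaseDimPiOneFree W → UnprojectedDense W`. (new) -/
theorem unprojectedDensityQuestion_of_base_eq_quarticCurve {W : Set (Fin 2 ⊕ Fin 2 → ℂ)}
    (hmm : MMCaseDimPiOneFree W)
    (hbase : zeroLocus ℂ (vanishingIdeal ℂ (projAdd '' (W ∩ torusLocus ℂ 2))) =
      {x : Fin 2 → ℂ | ∃ t : ℂ, x 0 = (Polynomial.X ^ 2 : Polynomial ℂ).eval t ∧
        x 1 = (Polynomial.X ^ 4 + Polynomial.X : Polynomial ℂ).eval t}) :
    UnprojectedDense W :=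
  unprojectedDense_of_mmCase_of_base_eq_paramCurve_of_not_comp _ _ (by simp)
    (by rw [natDegree_X_pow_four_add_X]; simp) X_pow_four_add_X_ne_comp_X_sq hmm hbase

/-- `i t⁴ + t` is not a polynomial in `t²` (compare the values at `t = ±1`). -/
theorem C_I_mul_X_pow_four_add_X_ne_comp_X_sq (P : Polynomial ℂ) :
    (Polynomial.C I * Polynomial.X ^ 4 + Polynomial.X : Polynomial ℂ) ≠ P.comp (Polynomial.X ^ 2) := by
  intro h
  have h1 := congrArg (Polynomial.eval (1 : ℂ)) h
  have h2 := congrArg (Polynomial.eval (-1 : ℂ)) h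
  simp only [Polynomial.eval_add, Polynomial.eval_mul, Polynomial.eval_C, Polynomial.eval_pow,
    Polynomial.eval_X, Polynomial.eval_comp] at h1 h2
  norm_num at h1 h2
  rw [← h1] at h2
  have h3 := congrArg Complex.re h2
  norm_num at h3

/-- **Mantova–Masser's question over the curve `(t², i t⁴ + t)`** (formerly in the residual class:
`2 ∣ 4`, vanishing phase `Re(i·i²) = 0`, no gap) **holds for EVERY surface of their case.** (new) -/
theorem unprojectedDensityQuestion_of_base_eq_iQuarticCurve {W : Set (Fin 2 ⊕ Fin 2 → ℂ)}
    (hmm : MMCaseDimPiOneFree W)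
    (hbase : zeroLocus ℂ (vanishingIdeal ℂ (projAdd '' (W ∩ torusLocus ℂ 2))) =
      {x : Fin 2 → ℂ | ∃ t : ℂ, x 0 = (Polynomial.X ^ 2 : Polynomial ℂ).eval t ∧
        x 1 = (Polynomial.C I * Polynomial.X ^ 4 + Polynomial.X : Polynomial ℂ).eval t}) :
    UnprojectedDense W :=
  unprojectedDense_of_mmCase_of_base_eq_paramCurve_of_not_comp _ _ (by simp)
    (by rw [natDegree_C_I_mul_X_pow_four_add_X]; simp) C_I_mul_X_pow_four_add_X_ne_comp_X_sq hmm hbase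

end Example

/-! ## Part C. Equal degrees with RATIONAL leading ratio: reduction to the unequal-degree answer -/

section RatRatio

variable (g₀ g₁ : Polynomial ℂ) {p q u v : ℤ}

/-- **Rational leading ratio.**  `deg g₀ = deg g₁ = n ≥ 2`, `p lc(g₀) + q lc(g₁) = 0`,
`p u + q v = 1`; reduced pair `G = p g₀ + q g₁` (degree `m < n`), `H = u g₁ - v g₀` (degree `n`).
If `m ≥ 2` and `H ∉ ℂ[G]`, then EVERY `W` of Mantova–Masser's case over `{(g₀(t), g₁(t))}` has
Zariski-dense exponential points (Bezout transport of gen 21 + the unequal-degree answer).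
[cite: MantovaMasser2023, §1 Further remarks, p. 5 (the question, open in general)] (new) -/
theorem unprojectedDense_of_mmCase_of_base_eq_paramCurve_of_ratRatio_of_not_comp
    (hbez : p * u + q * v = 1) (hn : 2 ≤ g₀.natDegree) (heq : g₁.natDegree = g₀.natDegree)
    (hpq : (p : ℂ) * g₀.leadingCoeff + (q : ℂ) * g₁.leadingCoeff = 0)
    {G H : Polynomial ℂ} (hG : G = Polynomial.C (p : ℂ) * g₀ + Polynomial.C (q : ℂ) * g₁)
    (hH : H = Polynomial.C (u : ℂ) * g₁ - Polynomial.C (v : ℂ) * g₀)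
    (hm : 2 ≤ G.natDegree) (hng : ∀ P : Polynomial ℂ, H ≠ P.comp G)
    {W : Set (Fin 2 ⊕ Fin 2 → ℂ)} (hmm : MMCaseDimPiOneFree W)
    (hbase : zeroLocus ℂ (vanishingIdeal ℂ (projAdd '' (W ∩ torusLocus ℂ 2))) =
      {x : Fin 2 → ℂ | ∃ t : ℂ, x 0 = g₀.eval t ∧ x 1 = g₁.eval t}) :
    UnprojectedDense W := by
  have hHd := (natDegree_ratRed_snd g₀ g₁ hbez (by omega) heq hpq hH).1
  have hlt : G.natDegree < H.natDegree := by
    rw [hHd]; exact natDegree_ratRed_lt g₀ g₁ (by omega) heq hpq hG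
  exact unprojectedDense_of_mmCase_of_base_eq_paramCurve_bezout g₀ g₁ hbez hG hH
    (fun W' hW' hb' =>
      unprojectedDense_of_mmCase_of_base_eq_paramCurve_of_not_comp G H hm hlt hng hW' hb') hmm hbase

end RatRatio

end Summit.Schanuel.Schanuel.Theorems
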